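import Literature.Computability.AlgebraicComplexity.BurgisserRootCountGRH
import Literature.NumberTheory.LFunctions.EffectivePrimeIdealTheoremGRHProofs
import HarnessLib

/-!
# Bürgisser 2000 TCS, Cor. 4.8 (roots modulo primes under GRH): the discharge

Topic `Literature/Computability/AlgebraicComplexity` (namespace
`Literature.Computability.AlgebraicComplexity`, sibling of `BurgisserReductionModPrimes.lean` and
`BurgisserRootCountGRH.lean`). Everything in this file is PROVED.

P. Bürgisser, *Cook's versus Valiant's hypothesis*, Theoret. Comput. Sci. 235 (2000), 71–88,
Cor. 4.8 (p. 84): *under GRH there is an absolute constant `c > 0` such that for every irreducible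
`g ∈ ℤ[Y]` of degree `d` and weight `w`, the number `π_g(x)` of primes `p ≤ x` modulo which `g` has
a root satisfies `π_g(x) ≥ π(x)/d − c(x^{1/2} log(dwx) + d log(dw))`* — the tree's named fact
`rootModPrimeCount_lower_bound_of_GRH` (`BurgisserReductionModPrimes.lean`). Bürgisser derives it
(p. 83, eq. (3) and Thm. 4.7) from the effective prime ideal theorem under GRH of Lagarias–Odlyzko
and Weinberger, in Serre's uniform form. The tree reduced the fact to that single input
(`rootModPrimeCount_lower_bound_of_GRH_of_effectivePrimeIdealTheorem`, `BurgisserRootCountGRH.lean`);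
the input is now a theorem (`NumberField.effectivePrimeIdealTheorem_of_ERH_holds`,
`EffectivePrimeIdealTheoremGRHProofs.lean`, resting on the uniform GRH bound for `ψ_K` of
`DedekindPsiGRHBound.lean`), so Cor. 4.8 is DISCHARGED:

* `rootModPrimeCount_lower_bound_of_GRH_holds`.

## References

* P. Bürgisser, *Cook's versus Valiant's hypothesis*, Theoret. Comput. Sci. 235 (2000), 71–88,
  Cor. 4.8 (p. 84), Thm. 4.7 and eq. (3) (p. 83). [cite: Burgisser2000TCS, Cor. 4.8 p. 84]
* J.-P. Serre, *Quelques applications du théorème de densité de Chebotarev*, Publ. Math. IHÉS 54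
  (1981), Thm. 4. [cite: Serre1981, Thm. 4 (14_R) p. 133]
* J. C. Lagarias, A. M. Odlyzko, *Effective versions of the Chebotarev density theorem* (1977),
  Thm. 1.1. [cite: LagariasOdlyzko1977, Thm. 1.1]
-/

noncomputable section

namespace Literature.Computability.AlgebraicComplexity

/-- **Bürgisser 2000 TCS, Cor. 4.8 holds**: under GRH, `π_g(x) ≥ π(x)/d − c(√x log(dwx) + d log(dw))`
for every irreducible `g ∈ ℤ[Y]` of degree `d ≥ 1` and weight `w`, with an absolute `c` — the named
fact `rootModPrimeCount_lower_bound_of_GRH` is a theorem, by the tree's reduction to the effective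
prime ideal theorem under GRH (`rootModPrimeCount_lower_bound_of_GRH_of_effectivePrimeIdealTheorem`)
and its discharge `NumberField.effectivePrimeIdealTheorem_of_ERH_holds`.
[cite: Burgisser2000TCS, Cor. 4.8 p. 84] -/
theorem rootModPrimeCount_lower_bound_of_GRH_holds : rootModPrimeCount_lower_bound_of_GRH :=
  rootModPrimeCount_lower_bound_of_GRH_of_effectivePrimeIdealTheorem
    Literature.NumberTheory.LFunctions.NumberField.effectivePrimeIdealTheorem_of_ERH_holds

end Literature.Computability.AlgebraicComplexity

end
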